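import Summits.RiemannHypothesis.RiemannHypothesis.Theses.ScrewMultisection
import Summits.RiemannHypothesis.RiemannHypothesis.Theorems.Splittings.ScrewLatticeThinWall
import HarnessLib

/-!
# Route ScrewMultisection (L37 «MULTISECTION») — `Assembly` (item stmt-RiemannHypothesis-23146)

`MultisectionBridge → PeriodicSignsRaysFree → ThinWallOne → RiemannHypothesis` is three lines of logic
over the landed row X-10: unpack the period `q ≥ 1` with the eventual `q`-periodicity of the sign pattern
of `Ψ(k)` and the `q` wall-free rays from `PeriodicSignsRaysFree`; `MultisectionBridge` at step `h = 1`
turns them into `LatticeCeiling 1`; `ScrewLatticeThinWall.rh_of_latticeCeiling_of_thinWall one_pos` with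
`ThinWallOne` (= `ThinWall 1`) gives RH. This is the planner's kernel-checked `assembly_holds` (rh-idea-1 g0,
multisection/Sketch6.lean sha16 e0fef3a4a34490aa ll. 45–48), typed by the route decl (route file sha16
62bf2632c0854bbb). CONDITIONAL bookkeeping: the RH-free crux `MultisectionBridge` and the RH-implied
`PeriodicSignsRaysFree`, `ThinWallOne` stay OPEN — RH is not proved by this; nothing here bears on the
truth of RH.
-/

-- D-0017: `Summit.RiemannHypothesis.RiemannHypothesis.…` duplicates the namespace BY DESIGN (single-problem summit).
set_option linter.dupNamespace false

namespace Summit.RiemannHypothesis.RiemannHypothesis.Theorems.ScrewMultisection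

open Summit.RiemannHypothesis.RiemannHypothesis.Theorems.Splittings in
/-- **`Assembly` (item stmt-RiemannHypothesis-23146) holds**: `PeriodicSignsRaysFree` supplies the period
`q` with the eventual sign periodicity and the wall-free rays, `MultisectionBridge 1 one_pos q …` is
`LatticeCeiling 1`, and row X-10 `rh_of_latticeCeiling_of_thinWall` with `ThinWall 1` gives RH. Pure logic
(planner rh-idea-1's `assembly_holds`, e0fef3a4). -/
theorem assembly_proof :
    Summit.RiemannHypothesis.RiemannHypothesis.Theses.ScrewMultisection.Assembly := by
  intro h₁ h₂ h₃
  obtain ⟨q, hq, hper, hrays⟩ := h₂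
  exact ScrewLatticeThinWall.rh_of_latticeCeiling_of_thinWall one_pos (h₁ 1 one_pos q hq hper hrays) h₃

end Summit.RiemannHypothesis.RiemannHypothesis.Theorems.ScrewMultisection
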